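import Mathlib
import Literature.NumberTheory.Automorphic.FuchsianEisensteinResolvent
import Literature.NumberTheory.Automorphic.FuchsianEisensteinTruncationAnalytic

/-!
# Meromorphic continuation of the Eisenstein series, II: identification with the Eisenstein data
and the normal forms on a strip (Iwaniec, *Spectral Methods of Automorphic Forms*, GSM 53,
§6.2 (6.10)–(6.18), Prop. 6.8; PDF pp. 84–85, 88)

Twenty-first brick of the general-`Γ` Eisenstein series, fifth file of **Chapter 6** (towards
`Iwaniec2002_eq_12_5` / `Iwaniec2002_thm_12_1` through `Fuchsian.SpectralParts`). Continues
`FuchsianEisensteinResolvent` (the meromorphic families `vPart`, `rPart`, `gramM`, `cvec`, `phiRaw`,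
`vRaw`, `resid` on the strip `S_k` of a resolvent kernel, non-degenerate at `s₀`). Everything is
PROVED; no fact is introduced.

1. (§5) **For `Re s > 1` the Eisenstein data solve the system.** The resolvent identity in `L²(F)`:
   `(T_k - ĥ_k(s)) [E^Y(s)] + [aᵢ^s] + Σⱼ φᵢⱼ(s) [aⱼ^{1-s}] = 0` (`resolventIdentity_Lp`, from the
   pointwise `resolventIdentity_of_re_gt_one`); projecting to `L²_Y` and inverting `ĥ_k(s) - T^Y_k`:
   `[E^Y(s)] = v_none(s) + Σⱼ φᵢⱼ(s) vⱼ(s)` (`eisTruncLp_eq_vPart`); pairing the vanishing total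
   residual with `rₘ(s₀)`: `gramM(s) φ⃗ᵢ(s) = cvec(s)` (`gramM_mulVec_eisScattering`); so where
   `det gramM(s) ≠ 0`: `phiRaw = (φᵢⱼ)ⱼ`, `ι vRaw = [E^Y]`, `resid = 0` — in particular on a
   neighbourhood of `s₀` (`eventually_phiRaw_eq_and_vRaw_eq`).
2. (§6) **The normal forms** `phiN i j = φ^k_{ij} : ℂ → ℂ` and `vN i = v^k_i : ℂ → L²_Y`
   (`toMeromorphicNFOn` of the raw continuations on the strip): meromorphic in normal form on `S_k`
   (values `0` at poles, `analyticAt_phiN_or`, `analyticAt_vN_or`); **equal to `φᵢⱼ` and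
   `P_Y [E^Y_𝔞ᵢ(·, s)]` on `S_k ∩ {Re s > 1}` and analytic there** (`phiN_eqOn_and_analyticOnNhd`,
   `vN_eqOn_and_analyticOnNhd`, `coe_vN_eq_eisTruncLp`, identity theorem for normal forms); **the
   resolvent identity holds at every point of the strip where `v^k_i` and the `φ^k_{ij}` are
   analytic, for EVERY Lipschitz test kernel `k'`** (not only the resolvent kernel):
   `(T_{k'} - ĥ_{k'}(s)) ι v^k_i(s) + [a_{k',i}^s] + Σⱼ φ^k_{ij}(s) [a_{k',j}^{1-s}] = 0` (`residK_eq_zero`: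
   the residual `residK` is meromorphic on the strip and vanishes on `S_k ∩ {Re s > 1}` by
   `resolventIdentity_Lp_of_kernel`) — i.e. `(L_{k'} - ĥ_{k'}(s)) Ẽᵢ(·, s) = 0` a.e. on `F` for the
   continued `Ẽᵢ(s) = ι v(s) + θᵢ^s + Σⱼ φᵢⱼ(s) θⱼ^{1-s}`, the input of the regularity criterion
   (Theorems 1.9/1.15/1.16) in the next file; and **two resolvent kernels give the same functions on
   the common part of their strips** (`phiN_eqOn_inter`, `vN_eqOn_inter`), so that the kernels
   `RKernel.ofStrip N` patch to all of `ℂ` (next file).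

This is Iwaniec's Proposition 6.8 together with "we also obtain the meromorphic continuation of the
coefficients `φ_𝔞𝔟(s)`" (after (6.18)), in a strip, with `L²_Y`-valued `E^Y`.

## References
* [Iwaniec2002] H. Iwaniec, *Spectral Methods of Automorphic Forms*, 2nd ed., GSM 53, AMS 2002,
  §6.2, (6.10)–(6.18), Prop. 6.8, PDF pp. 84–85, 88
  (held copy `book:iwaniec2002-spectral-methods-automorphic-forms`).
* [Colindeverdiere1983] Y. Colin de Verdière, *Pseudo-laplaciens II*, Ann. Inst. Fourier 33 (1983) 87–113.
* [Garrett2018] P. Garrett, *Modern Analysis of Automorphic Forms by Example*, vol. 1, CUP 2018, §1.10–1.11.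

Mathlib: `toMeromorphicNFOn`, `meromorphicNFOn_toMeromorphicNFOn`, `meromorphicNFAt_iff_analyticAt_or`,
`Matrix.nonsing_inv_mul`, `Matrix.mulVec_mulVec`, `Submodule.starProjection_eq_self_iff`,
`DifferentiableOn.analyticOnNhd`. Literature: `vPart`, `rPart`, `gramM`, `cvec`, `phiRaw`, `vRaw`, `resid`,
`exists_ball_baseParam`, `kernelCLM_toLp_coeFn_of_isAutomorphic`, `sum_smul_rPart_some`
(`FuchsianEisensteinResolvent`); `RKernel`, `baseParam`, `MeromorphicNFOn.eqOn_and_analyticOnNhd`,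
`MeromorphicNFOn.eqOn_of_eventuallyEq`, `toMeromorphicNFOn_eventuallyEq_of_eventuallyEq` (`ResolventKernels`);
`eisTruncLp`, `eisTruncLp_eq_toLp`, `analyticOnNhd_eisTruncLp` (`FuchsianEisensteinTruncationAnalytic`);
`resolventIdentity_of_re_gt_one`, `tailDefectLp_coeFn`, `memLp_tailDefect` (`FuchsianEisensteinTails`);
`memLp_eisTrunc`, `isAutomorphic_eisTrunc` (`FuchsianEisensteinTruncation`); `eisTrunc_mem_pseudoCuspSubmodule`,
`pseudoCuspKernelCLM_apply` (`FuchsianPseudoCuspForms`); `differentiableOn_eisScattering`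
(`FuchsianEisensteinHolomorphy`); `sub_apply_resolvent`, `eq_resolvent_of_sub_eq`,
`MeromorphicOn.eq_zero_of_eventually_eq_zero`, `MeromorphicOn.eventually_eq_zero_of_eventually_eq_zero`
(`Literature.Analysis.OperatorTheory.CompactSelfAdjointResolvent`).
-/

noncomputable section

namespace Literature.NumberTheory.Automorphic

open _root_.MeasureTheory _root_.Set _root_.Filter _root_.Real _root_.Topology _root_.Metric _root_.UpperHalfPlane
open _root_.Literature.Analysis.OperatorTheory.CompactResolvent
open scoped _root_.ENNReal _root_.NNReal _root_.MatrixGroups _root_.Pointwise _root_.InnerProductSpace _root_.Matrix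

namespace Fuchsian

variable {Γ : Subgroup (GL (Fin 2) ℝ)} {F : Set ℍ} {h : ℕ} {𝔞 : Fin h → OnePoint ℝ} {σ : Fin h → SL(2, ℝ)}

/-! ## 5. For `Re s > 1` the Eisenstein data solve the system, so `φ⃗ = (φᵢⱼ)ⱼ` and `v = [E^Y]` near `s₀` -/

section TrueData

variable (hΓ : Γ ≤ (Matrix.SpecialLinearGroup.toGL : SL(2, ℝ) →* GL (Fin 2) ℝ).range)
  (hneg : (-1 : GL (Fin 2) ℝ) ∈ Γ) (hd : IsDiscreteSubgroup Γ) (hF : IsHypFundamentalDomain Γ F)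
  (hvol : volume F < ⊤)
  (hinfty : ∀ i, (Matrix.SpecialLinearGroup.toGL (σ i) : GL (Fin 2) ℝ) • (OnePoint.infty : OnePoint ℝ) = 𝔞 i)
  (hper : ∀ i, (ConjAct.toConjAct (Matrix.SpecialLinearGroup.toGL (σ i) : GL (Fin 2) ℝ)⁻¹ • Γ).strictPeriods =
    AddSubgroup.zmultiples 1)
  (hineq : ∀ i j, ∀ γ ∈ Γ, γ • 𝔞 i = 𝔞 j → i = j)
  (hcomplete : ∀ c : OnePoint ℝ, IsCusp c Γ → ∃ i, ∃ γ ∈ Γ, γ • 𝔞 i = c)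
  (κ : RKernel) {Y : ℝ} (hY : 1 ≤ Y)

include hΓ hneg hd hF hvol hinfty hper hineq hcomplete hY in
/-- **The resolvent identity in `L²(F)`** for `Re s > 1` and any Lipschitz test kernel `k`:
`(T_k - ĥ_k(s)) [E^Y] + [aᵢ^s] + Σⱼ φᵢⱼ(s) [aⱼ^{1-s}] = 0` (the defects `a = a_k` of the kernel `k`).
[cite: Iwaniec2002, §6.1 (6.6), PDF p. 83] -/
theorem resolventIdentity_Lp_of_kernel {k : ℝ → ℝ} {L : ℝ≥0} {Bk M : ℝ} (hk : IsTestKernel k) (hL : LipschitzWith L k)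
    (hBk : ∀ u, |k u| ≤ Bk) (hM : ∀ u, M ≤ u → k u = 0) (i : Fin h) {s : ℂ} (hs : 1 < s.re) :
    kernelCLM hΓ hneg hd hF hk hL.continuous (eisTruncLp Γ F σ i s Y) - eigenvalueFn k s • eisTruncLp Γ F σ i s Y
      + tailDefectLp Γ F σ k i s Y + ∑ j, eisScattering Γ σ i j s • tailDefectLp Γ F σ k j (1 - s) Y = 0 := by
  have hmemE := memLp_eisTrunc hΓ hneg hd hF hvol hinfty hper hineq hcomplete hs i hY
  have hmemD : ∀ (j : Fin h) (w : ℂ), MemLp (tailDefect Γ σ k j w Y) 2 (volume.restrict F) := fun j w =>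
    memLp_tailDefect (F := F) hΓ hneg hd hvol hinfty hper hineq hk hL hBk hM j w hY
  rw [eisTruncLp_eq_toLp hmemE]
  refine Lp.ext ?_
  have hsm : ∀ j, (⇑(eisScattering Γ σ i j s • tailDefectLp Γ F σ k j (1 - s) Y) : ℍ → ℂ) =ᵐ[volume.restrict F]
      fun z => eisScattering Γ σ i j s * tailDefect Γ σ k j (1 - s) Y z := by
    intro j
    filter_upwards [Lp.coeFn_smul (eisScattering Γ σ i j s) (tailDefectLp Γ F σ k j (1 - s) Y),
      tailDefectLp_coeFn (hmemD j (1 - s))] with z hz1 hz2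
    rw [hz1, Pi.smul_apply, hz2, smul_eq_mul]
  filter_upwards [Lp.coeFn_add (kernelCLM hΓ hneg hd hF hk hL.continuous (hmemE.toLp _) - eigenvalueFn k s • hmemE.toLp _ +
      tailDefectLp Γ F σ k i s Y) (∑ j, eisScattering Γ σ i j s • tailDefectLp Γ F σ k j (1 - s) Y),
    Lp.coeFn_add (kernelCLM hΓ hneg hd hF hk hL.continuous (hmemE.toLp _) - eigenvalueFn k s • hmemE.toLp _)
      (tailDefectLp Γ F σ k i s Y),
    Lp.coeFn_sub (kernelCLM hΓ hneg hd hF hk hL.continuous (hmemE.toLp _)) (eigenvalueFn k s • hmemE.toLp _),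
    Lp.coeFn_smul (eigenvalueFn k s) (hmemE.toLp _), MemLp.coeFn_toLp hmemE,
    kernelCLM_toLp_coeFn_of_isAutomorphic hΓ hneg hd hF hk hL.continuous (isAutomorphic_eisTrunc hΓ i s Y) hmemE,
    Lp.coeFn_fun_finsetSum Finset.univ (fun j => eisScattering Γ σ i j s • tailDefectLp Γ F σ k j (1 - s) Y),
    ae_all_iff.mpr hsm, tailDefectLp_coeFn (hmemD i s),
    Lp.coeFn_zero ℂ 2 (volume.restrict F)] with z h1 h2 h3 h4 h5 h6 h7 h8 h9 h10
  rw [h1, Pi.add_apply, h2, Pi.add_apply, h3, Pi.sub_apply, h4, Pi.smul_apply, h5, h6, h7, h9, h10, Pi.zero_apply,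
    smul_eq_mul, Finset.sum_congr rfl fun j _ => h8 j]
  exact resolventIdentity_of_re_gt_one hΓ hneg hd hF hvol hinfty hper hineq hcomplete hk i hs hY z

include hΓ hneg hd hF hvol hinfty hper hineq hcomplete hY in
/-- **The resolvent identity in `L²(F)`** for `Re s > 1`, for the resolvent kernel itself:
`(T_k - ĥ_k(s)) [E^Y] + src_none(s) + Σⱼ φᵢⱼ(s) src_j(s) = 0`. [cite: Iwaniec2002, §6.1 (6.6), PDF p. 83] -/
theorem resolventIdentity_Lp (i : Fin h) {s : ℂ} (hs : 1 < s.re) :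
    Tk hΓ hneg hd hF κ (eisTruncLp Γ F σ i s Y) - eigenvalueFn κ.k s • eisTruncLp Γ F σ i s Y
      + src Γ F σ κ Y i none s + ∑ j, eisScattering Γ σ i j s • src Γ F σ κ Y i (some j) s = 0 :=
  resolventIdentity_Lp_of_kernel hΓ hneg hd hF hvol hinfty hper hineq hcomplete hY κ.test κ.lip κ.bound κ.supp i hs

include hvol hinfty hper hineq hcomplete hY in
/-- `[E^Y_𝔞ᵢ(·, s)] ∈ L²_Y` for `Re s > 1`. [cite: Iwaniec2002, §6.2 (6.10), PDF p. 84] -/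
theorem eisTruncLp_mem_pseudoCuspSubmodule (i : Fin h) {s : ℂ} (hs : 1 < s.re) :
    eisTruncLp Γ F σ i s Y ∈ pseudoCuspSubmodule hΓ hneg hd hF σ Y := by
  rw [eisTruncLp_eq_toLp (memLp_eisTrunc hΓ hneg hd hF hvol hinfty hper hineq hcomplete hs i hY)]
  exact eisTrunc_mem_pseudoCuspSubmodule hΓ hneg hd hF (hper := hper) (hvol := hvol) (hinfty := hinfty)
    (hineq := hineq) (hcomplete := hcomplete) hs i hY

/-- Expansion of the total combination (with the `none` term). [folklore] -/
theorem rPart_none_add_sum_smul (i : Fin h) (g : Fin h → ℂ) (s : ℂ) :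
    rPart hΓ hneg hd hF σ κ Y i none s + ∑ j, g j • rPart hΓ hneg hd hF σ κ Y i (some j) s =
      Tk hΓ hneg hd hF κ (((vPart hΓ hneg hd hF σ κ Y i none s + ∑ j, g j • vPart hΓ hneg hd hF σ κ Y i (some j) s :
          pseudoCuspSubmodule hΓ hneg hd hF σ Y) : Lp ℂ 2 (volume.restrict F)))
        - eigenvalueFn κ.k s • (((vPart hΓ hneg hd hF σ κ Y i none s + ∑ j, g j • vPart hΓ hneg hd hF σ κ Y i (some j) s :
          pseudoCuspSubmodule hΓ hneg hd hF σ Y) : Lp ℂ 2 (volume.restrict F)))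
        + (src Γ F σ κ Y i none s + ∑ j, g j • src Γ F σ κ Y i (some j) s) := by
  rw [sum_smul_rPart_some]
  simp only [rPart, Submodule.coe_add, map_add, smul_add]
  abel

/-- **The `P_Y`-component of each residual vanishes** (by construction of the resolvent parts). [folklore] -/
theorem orthogonalProjectionOnto_rPart {s : ℂ} (hs : eigenvalueFn κ.k s ∈ resolventSet ℂ (TY hΓ hneg hd hF σ κ Y))
    (i : Fin h) (o : Option (Fin h)) :
    (pseudoCuspSubmodule hΓ hneg hd hF σ Y).orthogonalProjectionOnto (rPart hΓ hneg hd hF σ κ Y i o s) = 0 := by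
  have h1 : eigenvalueFn κ.k s • vPart hΓ hneg hd hF σ κ Y i o s - TY hΓ hneg hd hF σ κ Y (vPart hΓ hneg hd hF σ κ Y i o s) =
      (pseudoCuspSubmodule hΓ hneg hd hF σ Y).orthogonalProjectionOnto (src Γ F σ κ Y i o s) :=
    sub_apply_resolvent hs _
  have h2 : (pseudoCuspSubmodule hΓ hneg hd hF σ Y).orthogonalProjectionOnto
      (Tk hΓ hneg hd hF κ ((vPart hΓ hneg hd hF σ κ Y i o s : pseudoCuspSubmodule hΓ hneg hd hF σ Y) :
        Lp ℂ 2 (volume.restrict F))) = TY hΓ hneg hd hF σ κ Y (vPart hΓ hneg hd hF σ κ Y i o s) := rfl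
  simp only [rPart, map_add, map_sub, map_smul, Submodule.orthogonalProjectionOnto_mem_subspace_eq_self, h2]
  rw [← h1]
  abel

include hvol hinfty hper hineq hcomplete hY in
/-- **The Eisenstein data solve the system** (`Re s > 1`, `ĥ_k(s) ∈ ρ(T^Y_k)`):
`[E^Y(s)] = v_none(s) + Σⱼ φᵢⱼ(s) v_{some j}(s)`. [cite: Iwaniec2002, §6.2 (6.10), PDF p. 84] -/
theorem eisTruncLp_eq_vPart (i : Fin h) {s : ℂ} (hs : 1 < s.re)
    (hres : eigenvalueFn κ.k s ∈ resolventSet ℂ (TY hΓ hneg hd hF σ κ Y)) :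
    eisTruncLp Γ F σ i s Y =
      (((vPart hΓ hneg hd hF σ κ Y i none s + ∑ j, eisScattering Γ σ i j s • vPart hΓ hneg hd hF σ κ Y i (some j) s :
          pseudoCuspSubmodule hΓ hneg hd hF σ Y)) : Lp ℂ 2 (volume.restrict F)) := by
  let vt : pseudoCuspSubmodule hΓ hneg hd hF σ Y :=
    ⟨eisTruncLp Γ F σ i s Y, eisTruncLp_mem_pseudoCuspSubmodule hΓ hneg hd hF hvol hinfty hper hineq hcomplete hY i hs⟩
  have hE := resolventIdentity_Lp hΓ hneg hd hF hvol hinfty hper hineq hcomplete κ hY i hs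
  -- apply `P_Y`
  have hP := congrArg (pseudoCuspSubmodule hΓ hneg hd hF σ Y).orthogonalProjectionOnto hE
  have hvt' : (vt : Lp ℂ 2 (volume.restrict F)) = eisTruncLp Γ F σ i s Y := rfl
  have h2 : (pseudoCuspSubmodule hΓ hneg hd hF σ Y).orthogonalProjectionOnto
      (Tk hΓ hneg hd hF κ ((vt : pseudoCuspSubmodule hΓ hneg hd hF σ Y) : Lp ℂ 2 (volume.restrict F))) =
        TY hΓ hneg hd hF σ κ Y vt := rfl
  rw [← hvt'] at hP ⊢
  simp only [map_add, map_sub, map_smul, map_sum, map_zero, Submodule.orthogonalProjectionOnto_mem_subspace_eq_self,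
    h2] at hP
  -- `(μ - T^Y) vt = P src_none + Σ φⱼ P srcⱼ`
  have hsub : eigenvalueFn κ.k s • vt - TY hΓ hneg hd hF σ κ Y vt =
      (pseudoCuspSubmodule hΓ hneg hd hF σ Y).orthogonalProjectionOnto (src Γ F σ κ Y i none s) +
        ∑ j, eisScattering Γ σ i j s •
          (pseudoCuspSubmodule hΓ hneg hd hF σ Y).orthogonalProjectionOnto (src Γ F σ κ Y i (some j) s) := by
    rw [← sub_eq_zero, ← neg_eq_zero, ← hP]
    abel
  have hv := eq_resolvent_of_sub_eq hres hsub
  rw [hv]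
  simp only [vPart, map_add, map_sum, map_smul]

include hvol hinfty hper hineq hcomplete hY in
/-- **The total residual of the Eisenstein data vanishes**: `r_none(s) + Σⱼ φᵢⱼ(s) rⱼ(s) = 0`. [folklore] -/
theorem rPart_none_add_sum_eisScattering_smul (i : Fin h) {s : ℂ} (hs : 1 < s.re)
    (hres : eigenvalueFn κ.k s ∈ resolventSet ℂ (TY hΓ hneg hd hF σ κ Y)) :
    rPart hΓ hneg hd hF σ κ Y i none s + ∑ j, eisScattering Γ σ i j s • rPart hΓ hneg hd hF σ κ Y i (some j) s = 0 := by
  rw [rPart_none_add_sum_smul, ← eisTruncLp_eq_vPart hΓ hneg hd hF hvol hinfty hper hineq hcomplete κ hY i hs hres]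
  have := resolventIdentity_Lp hΓ hneg hd hF hvol hinfty hper hineq hcomplete κ hY i hs
  rw [← this]
  abel

include hvol hinfty hper hineq hcomplete hY in
/-- **The Gram system holds for the true scattering row**: `G(s) φ⃗ᵢ(s) = c(s)`. [folklore] -/
theorem gramM_mulVec_eisScattering (i : Fin h) {s : ℂ} (hs : 1 < s.re)
    (hres : eigenvalueFn κ.k s ∈ resolventSet ℂ (TY hΓ hneg hd hF σ κ Y)) :
    gramM hΓ hneg hd hF σ κ Y i s *ᵥ (fun j => eisScattering Γ σ i j s) = cvec hΓ hneg hd hF σ κ Y i s := by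
  funext m
  have h0 := congrArg (fun u => ⟪rPart hΓ hneg hd hF σ κ Y i (some m) baseParam, u⟫_ℂ)
    (rPart_none_add_sum_eisScattering_smul hΓ hneg hd hF hvol hinfty hper hineq hcomplete κ hY i hs hres)
  simp only [inner_add_right, inner_sum, inner_smul_right, inner_zero_right] at h0
  simp only [Matrix.mulVec, dotProduct, gramM, cvec, Matrix.of_apply]
  rw [eq_neg_iff_add_eq_zero, add_comm]
  simpa only [mul_comm] using h0

include hvol hinfty hper hineq hcomplete hY in
/-- **`φ⃗(s) = (φᵢⱼ(s))ⱼ`** wherever `Re s > 1`, `ĥ_k(s) ∈ ρ(T^Y_k)` and `det G(s) ≠ 0`. [folklore] -/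
theorem phiRaw_eq_eisScattering (i : Fin h) {s : ℂ} (hs : 1 < s.re)
    (hres : eigenvalueFn κ.k s ∈ resolventSet ℂ (TY hΓ hneg hd hF σ κ Y))
    (hdet : (gramM hΓ hneg hd hF σ κ Y i s).det ≠ 0) (j : Fin h) :
    phiRaw hΓ hneg hd hF σ κ Y i s j = eisScattering Γ σ i j s := by
  have hG := gramM_mulVec_eisScattering hΓ hneg hd hF hvol hinfty hper hineq hcomplete κ hY i hs hres
  unfold phiRaw
  rw [← hG, Matrix.mulVec_mulVec, Matrix.nonsing_inv_mul _ (isUnit_iff_ne_zero.mpr hdet), Matrix.one_mulVec]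

include hvol hinfty hper hineq hcomplete hY in
/-- **`v(s) = [E^Y_𝔞ᵢ(·, s)]`** under the same conditions. [folklore] -/
theorem coe_vRaw_eq_eisTruncLp (i : Fin h) {s : ℂ} (hs : 1 < s.re)
    (hres : eigenvalueFn κ.k s ∈ resolventSet ℂ (TY hΓ hneg hd hF σ κ Y))
    (hdet : (gramM hΓ hneg hd hF σ κ Y i s).det ≠ 0) :
    ((vRaw hΓ hneg hd hF σ κ Y i s : pseudoCuspSubmodule hΓ hneg hd hF σ Y) : Lp ℂ 2 (volume.restrict F)) =
      eisTruncLp Γ F σ i s Y := by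
  rw [eisTruncLp_eq_vPart hΓ hneg hd hF hvol hinfty hper hineq hcomplete κ hY i hs hres]
  unfold vRaw
  simp_rw [phiRaw_eq_eisScattering hΓ hneg hd hF hvol hinfty hper hineq hcomplete κ hY i hs hres hdet]

include hvol hinfty hper hineq hcomplete hY in
/-- **The total residual vanishes** under the same conditions. [folklore] -/
theorem resid_eq_zero (i : Fin h) {s : ℂ} (hs : 1 < s.re)
    (hres : eigenvalueFn κ.k s ∈ resolventSet ℂ (TY hΓ hneg hd hF σ κ Y))
    (hdet : (gramM hΓ hneg hd hF σ κ Y i s).det ≠ 0) :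
    resid hΓ hneg hd hF σ κ Y i s = 0 := by
  unfold resid
  simp_rw [phiRaw_eq_eisScattering hΓ hneg hd hF hvol hinfty hper hineq hcomplete κ hY i hs hres hdet]
  exact rPart_none_add_sum_eisScattering_smul hΓ hneg hd hF hvol hinfty hper hineq hcomplete κ hY i hs hres

include hvol hinfty hper hineq hcomplete hY in
/-- **Near `s₀` the raw continuations ARE the Eisenstein data.** [folklore] -/
theorem eventually_phiRaw_eq_and_vRaw_eq (i : Fin h) :
    ∀ᶠ s in 𝓝 baseParam, (∀ j, phiRaw hΓ hneg hd hF σ κ Y i s j = eisScattering Γ σ i j s) ∧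
      ((vRaw hΓ hneg hd hF σ κ Y i s : pseudoCuspSubmodule hΓ hneg hd hF σ Y) : Lp ℂ 2 (volume.restrict F)) =
        eisTruncLp Γ F σ i s Y ∧ resid hΓ hneg hd hF σ κ Y i s = 0 := by
  obtain ⟨ε, hε, hball⟩ := exists_ball_baseParam hΓ hneg hd hF hvol hinfty hper hineq κ hY i
  filter_upwards [Metric.ball_mem_nhds baseParam hε] with s hs
  obtain ⟨-, hre, him, hdet⟩ := hball s hs
  have hres := eigenvalueFn_mem_resolventSet_of_im_ne_zero hΓ hneg hd hF (σ := σ) κ (Y := Y) him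
  exact ⟨phiRaw_eq_eisScattering hΓ hneg hd hF hvol hinfty hper hineq hcomplete κ hY i hre hres hdet,
    coe_vRaw_eq_eisTruncLp hΓ hneg hd hF hvol hinfty hper hineq hcomplete κ hY i hre hres hdet,
    resid_eq_zero hΓ hneg hd hF hvol hinfty hper hineq hcomplete κ hY i hre hres hdet⟩

end TrueData

/-! ## 6. Normal forms on the strip; agreement with the Eisenstein data on `Re s > 1` -/


section NormalForms

variable (hΓ : Γ ≤ (Matrix.SpecialLinearGroup.toGL : SL(2, ℝ) →* GL (Fin 2) ℝ).range)
  (hneg : (-1 : GL (Fin 2) ℝ) ∈ Γ) (hd : IsDiscreteSubgroup Γ) (hF : IsHypFundamentalDomain Γ F)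
  (σ : Fin h → SL(2, ℝ)) (κ : RKernel) (Y : ℝ)

/-- **The continued scattering row on the strip** `φ^κ_{ij}` : the normal form of the raw
continuation (values `0` at the poles). [cite: Iwaniec2002, §6.2 (after (6.18)), PDF p. 85] -/
def phiN (i j : Fin h) : ℂ → ℂ :=
  toMeromorphicNFOn (fun s => phiRaw hΓ hneg hd hF σ κ Y i s j) κ.strip

/-- **The continued truncated Eisenstein series on the strip** `s ↦ [E^Y_𝔞ᵢ(·, s)] ∈ L²_Y` : the
normal form of the raw continuation. [cite: Iwaniec2002, §6.2 (6.10) & Prop. 6.8, PDF pp. 84, 88] -/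
def vN (i : Fin h) : ℂ → pseudoCuspSubmodule hΓ hneg hd hF σ Y :=
  toMeromorphicNFOn (vRaw hΓ hneg hd hF σ κ Y i) κ.strip

/-- The analytic `L²_Y`-valued germ of the true data: `s ↦ P_Y [E^Y_𝔞ᵢ(·, s)]` (`= [E^Y]` for
`Re s > 1`). [folklore] -/
def eisTruncH (i : Fin h) (s : ℂ) : pseudoCuspSubmodule hΓ hneg hd hF σ Y :=
  (pseudoCuspSubmodule hΓ hneg hd hF σ Y).orthogonalProjectionOnto (eisTruncLp Γ F σ i s Y)

/-- **The continued residual for an operator kernel `k`**: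
`(T_k - ĥ_k(s)) ι v(s) + [a_{k,i}^s] + Σⱼ φᵢⱼ(s) [a_{k,j}^{1-s}]` — the class in `L²(F)` of
`(L_k - ĥ_k(s)) Ẽᵢ(·, s)`, `Ẽᵢ(s) = ι v(s) + θᵢ^s + Σⱼ φᵢⱼ(s) θⱼ^{1-s}` being the continued Eisenstein
series; `k` need not be the resolvent kernel. [folklore] -/
def residK {k : ℝ → ℝ} (hk : IsTestKernel k) (hkc : Continuous k) (i : Fin h) (s : ℂ) : Lp ℂ 2 (volume.restrict F) :=
  kernelCLM hΓ hneg hd hF hk hkc ((vN hΓ hneg hd hF σ κ Y i s : pseudoCuspSubmodule hΓ hneg hd hF σ Y) : Lp ℂ 2 (volume.restrict F))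
    - eigenvalueFn k s • ((vN hΓ hneg hd hF σ κ Y i s : pseudoCuspSubmodule hΓ hneg hd hF σ Y) : Lp ℂ 2 (volume.restrict F))
    + tailDefectLp Γ F σ k i s Y + ∑ j, phiN hΓ hneg hd hF σ κ Y i j s • tailDefectLp Γ F σ k j (1 - s) Y

/-- `φ^κ` is in normal form on the strip. [folklore] -/
theorem meromorphicNFOn_phiN (i j : Fin h) : MeromorphicNFOn (phiN hΓ hneg hd hF σ κ Y i j) κ.strip :=
  meromorphicNFOn_toMeromorphicNFOn _ _

/-- `v^κ` is in normal form on the strip. [folklore] -/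
theorem meromorphicNFOn_vN (i : Fin h) : MeromorphicNFOn (vN hΓ hneg hd hF σ κ Y i) κ.strip :=
  meromorphicNFOn_toMeromorphicNFOn _ _

/-- The domain of agreement `W = strip ∩ {Re s > 1}` is open. [folklore] -/
theorem isOpen_strip_inter : IsOpen (κ.strip ∩ {s : ℂ | 1 < s.re}) :=
  κ.isOpen_strip.inter (isOpen_lt continuous_const Complex.continuous_re)

/-- … and convex, hence preconnected. [folklore] -/
theorem isPreconnected_strip_inter : IsPreconnected (κ.strip ∩ {s : ℂ | 1 < s.re}) :=
  (κ.convex_strip.inter (convex_halfSpace_re_gt 1)).isPreconnected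

/-- `s₀ ∈ W`. [folklore] -/
theorem baseParam_mem_strip_inter : baseParam ∈ κ.strip ∩ {s : ℂ | 1 < s.re} :=
  ⟨baseParam_mem_strip κ, one_lt_baseParam_re⟩

variable {σ Y}
variable (hvol : volume F < ⊤)
  (hinfty : ∀ i, (Matrix.SpecialLinearGroup.toGL (σ i) : GL (Fin 2) ℝ) • (OnePoint.infty : OnePoint ℝ) = 𝔞 i)
  (hper : ∀ i, (ConjAct.toConjAct (Matrix.SpecialLinearGroup.toGL (σ i) : GL (Fin 2) ℝ)⁻¹ • Γ).strictPeriods =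
    AddSubgroup.zmultiples 1)
  (hineq : ∀ i j, ∀ γ ∈ Γ, γ • 𝔞 i = 𝔞 j → i = j)
  (hcomplete : ∀ c : OnePoint ℝ, IsCusp c Γ → ∃ i, ∃ γ ∈ Γ, γ • 𝔞 i = c)
  (hY : 1 ≤ Y)

include hΓ hd hper in
/-- `φᵢⱼ` is analytic on `Re s > 1`. [cite: Iwaniec2002, §6.2, PDF p. 85] -/
theorem analyticOnNhd_eisScattering (i j : Fin h) : AnalyticOnNhd ℂ (eisScattering Γ σ i j) {s : ℂ | 1 < s.re} :=
  (differentiableOn_eisScattering hΓ hd hper i j).analyticOnNhd (isOpen_lt continuous_const Complex.continuous_re)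

include hvol hinfty hper hineq hcomplete hY in
/-- `s ↦ P_Y [E^Y(s)]` is analytic on `Re s > 1`. [folklore] -/
theorem analyticOnNhd_eisTruncH (i : Fin h) :
    AnalyticOnNhd ℂ (eisTruncH hΓ hneg hd hF σ Y i) {s : ℂ | 1 < s.re} := fun s hs =>
  ((pseudoCuspSubmodule hΓ hneg hd hF σ Y).orthogonalProjectionOnto).comp_analyticAt' 
    (analyticOnNhd_eisTruncLp hΓ hneg hd hF hvol hinfty hper hineq hcomplete i hY s hs)

include hvol hinfty hper hineq hcomplete hY in
/-- `ι P_Y [E^Y(s)] = [E^Y(s)]` for `Re s > 1`. [folklore] -/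
theorem coe_eisTruncH (i : Fin h) {s : ℂ} (hs : 1 < s.re) :
    ((eisTruncH hΓ hneg hd hF σ Y i s : pseudoCuspSubmodule hΓ hneg hd hF σ Y) : Lp ℂ 2 (volume.restrict F)) =
      eisTruncLp Γ F σ i s Y := by
  unfold eisTruncH
  rw [Submodule.coe_orthogonalProjectionOnto_apply, Submodule.starProjection_eq_self_iff]
  exact eisTruncLp_mem_pseudoCuspSubmodule hΓ hneg hd hF hvol hinfty hper hineq hcomplete hY i hs

include hvol hinfty hper hineq hcomplete hY in
/-- **Near `s₀`, `φ^κᵢⱼ = φᵢⱼ`.** [folklore] -/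
theorem phiN_eventuallyEq_baseParam (i j : Fin h) :
    phiN hΓ hneg hd hF σ κ Y i j =ᶠ[𝓝 baseParam] eisScattering Γ σ i j := by
  refine toMeromorphicNFOn_eventuallyEq_of_eventuallyEq
    (fun s hs => meromorphicOn_phiRaw_apply hΓ hneg hd hF hvol hinfty hper hineq hcomplete κ hY i j s hs)
    (baseParam_mem_strip κ) (analyticOnNhd_eisScattering hΓ hd hper i j baseParam one_lt_baseParam_re) ?_
  filter_upwards [eventually_phiRaw_eq_and_vRaw_eq hΓ hneg hd hF hvol hinfty hper hineq hcomplete κ hY i] with s hs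
  exact hs.1 j

include hvol hinfty hper hineq hcomplete hY in
/-- **Near `s₀`, `v^κᵢ = P_Y [E^Y_𝔞ᵢ]`.** [folklore] -/
theorem vN_eventuallyEq_baseParam (i : Fin h) :
    vN hΓ hneg hd hF σ κ Y i =ᶠ[𝓝 baseParam] eisTruncH hΓ hneg hd hF σ Y i := by
  refine toMeromorphicNFOn_eventuallyEq_of_eventuallyEq
    (meromorphicOn_vRaw hΓ hneg hd hF hvol hinfty hper hineq hcomplete κ hY i) (baseParam_mem_strip κ)
    (analyticOnNhd_eisTruncH hΓ hneg hd hF hvol hinfty hper hineq hcomplete hY i baseParam one_lt_baseParam_re) ?_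
  filter_upwards [eventually_phiRaw_eq_and_vRaw_eq hΓ hneg hd hF hvol hinfty hper hineq hcomplete κ hY i] with s hs
  unfold eisTruncH
  rw [← hs.2.1, Submodule.orthogonalProjectionOnto_mem_subspace_eq_self]

include hvol hinfty hper hineq hcomplete hY in
/-- **`φ^κᵢⱼ = φᵢⱼ` and `φ^κᵢⱼ` is analytic on `strip ∩ {Re s > 1}`.**
[cite: Iwaniec2002, §6.2, PDF p. 85] -/
theorem phiN_eqOn_and_analyticOnNhd (i j : Fin h) :
    EqOn (phiN hΓ hneg hd hF σ κ Y i j) (eisScattering Γ σ i j) (κ.strip ∩ {s : ℂ | 1 < s.re}) ∧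
      AnalyticOnNhd ℂ (phiN hΓ hneg hd hF σ κ Y i j) (κ.strip ∩ {s : ℂ | 1 < s.re}) :=
  (meromorphicNFOn_phiN hΓ hneg hd hF σ κ Y i j).eqOn_and_analyticOnNhd inter_subset_left
    ((analyticOnNhd_eisScattering hΓ hd hper i j).mono inter_subset_right) (isPreconnected_strip_inter κ)
    (baseParam_mem_strip_inter κ) (phiN_eventuallyEq_baseParam hΓ hneg hd hF κ hvol hinfty hper hineq hcomplete hY i j)

include hvol hinfty hper hineq hcomplete hY in
/-- **`v^κᵢ = P_Y [E^Y_𝔞ᵢ]` and `v^κᵢ` is analytic on `strip ∩ {Re s > 1}`.** [cite: Iwaniec2002, §6.2 (6.10), PDF p. 84] -/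
theorem vN_eqOn_and_analyticOnNhd (i : Fin h) :
    EqOn (vN hΓ hneg hd hF σ κ Y i) (eisTruncH hΓ hneg hd hF σ Y i) (κ.strip ∩ {s : ℂ | 1 < s.re}) ∧
      AnalyticOnNhd ℂ (vN hΓ hneg hd hF σ κ Y i) (κ.strip ∩ {s : ℂ | 1 < s.re}) :=
  (meromorphicNFOn_vN hΓ hneg hd hF σ κ Y i).eqOn_and_analyticOnNhd inter_subset_left
    ((analyticOnNhd_eisTruncH hΓ hneg hd hF hvol hinfty hper hineq hcomplete hY i).mono inter_subset_right)
    (isPreconnected_strip_inter κ) (baseParam_mem_strip_inter κ)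
    (vN_eventuallyEq_baseParam hΓ hneg hd hF κ hvol hinfty hper hineq hcomplete hY i)

include hvol hinfty hper hineq hcomplete hY in
/-- In particular `ι v^κᵢ(s) = [E^Y_𝔞ᵢ(·, s)]` for `s` in the strip with `Re s > 1`. [folklore] -/
theorem coe_vN_eq_eisTruncLp (i : Fin h) {s : ℂ} (hs : s ∈ κ.strip) (hre : 1 < s.re) :
    ((vN hΓ hneg hd hF σ κ Y i s : pseudoCuspSubmodule hΓ hneg hd hF σ Y) : Lp ℂ 2 (volume.restrict F)) =
      eisTruncLp Γ F σ i s Y := by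
  rw [(vN_eqOn_and_analyticOnNhd hΓ hneg hd hF κ hvol hinfty hper hineq hcomplete hY i).1 ⟨hs, hre⟩]
  exact coe_eisTruncH hΓ hneg hd hF hvol hinfty hper hineq hcomplete hY i hre

include hvol hinfty hper hineq hcomplete hY in
/-- `φ^κᵢⱼ(s) = φᵢⱼ(s)` for `s` in the strip with `Re s > 1`. [folklore] -/
theorem phiN_eq_eisScattering (i j : Fin h) {s : ℂ} (hs : s ∈ κ.strip) (hre : 1 < s.re) :
    phiN hΓ hneg hd hF σ κ Y i j s = eisScattering Γ σ i j s :=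
  (phiN_eqOn_and_analyticOnNhd hΓ hneg hd hF κ hvol hinfty hper hineq hcomplete hY i j).1 ⟨hs, hre⟩

variable {k : ℝ → ℝ} {L : ℝ≥0} {Bk M : ℝ}

include hvol hinfty hper hineq hY in
/-- **The continued residual is meromorphic on the strip.** [folklore] -/
theorem meromorphicOn_residK (hk : IsTestKernel k) (hL : LipschitzWith L k) (hBk : ∀ u, |k u| ≤ Bk)
    (hM : ∀ u, M ≤ u → k u = 0) (i : Fin h) :
    MeromorphicOn (residK hΓ hneg hd hF σ κ Y hk hL.continuous i) κ.strip := fun s hs => by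
  have hv : MeromorphicAt (fun s => ((vN hΓ hneg hd hF σ κ Y i s : pseudoCuspSubmodule hΓ hneg hd hF σ Y) :
      Lp ℂ 2 (volume.restrict F))) s :=
    ((pseudoCuspSubmodule hΓ hneg hd hF σ Y).subtypeL).comp_meromorphicAt ((meromorphicNFOn_vN hΓ hneg hd hF σ κ Y i) hs).meromorphicAt
  have ha := analyticOnNhd_tailDefectLp (F := F) hΓ hneg hd hvol hinfty hper hineq hk hL hBk hM
  unfold residK
  refine ((((kernelCLM hΓ hneg hd hF hk hL.continuous).comp_meromorphicAt hv).sub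
    ((analyticAt_eigenvalueFn hk s).meromorphicAt.smul hv)).add (ha i hY s (mem_univ _)).meromorphicAt).add ?_
  refine MeromorphicAt.fun_sum fun j _ => ?_
  exact ((meromorphicNFOn_phiN hΓ hneg hd hF σ κ Y i j) hs).meromorphicAt.smul
    (((ha j hY) (1 - s) (mem_univ _)).comp (analyticAt_const.sub analyticAt_id)).meromorphicAt

include hvol hinfty hper hineq hcomplete hY in
/-- **The continued residual vanishes on `strip ∩ {Re s > 1}`** (there it is the resolvent identity).
[folklore] -/
theorem residK_eq_zero_of_one_lt_re (hk : IsTestKernel k) (hL : LipschitzWith L k) (hBk : ∀ u, |k u| ≤ Bk)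
    (hM : ∀ u, M ≤ u → k u = 0) (i : Fin h) {s : ℂ} (hs : s ∈ κ.strip) (hre : 1 < s.re) :
    residK hΓ hneg hd hF σ κ Y hk hL.continuous i s = 0 := by
  unfold residK
  rw [coe_vN_eq_eisTruncLp hΓ hneg hd hF κ hvol hinfty hper hineq hcomplete hY i hs hre]
  simp_rw [fun j => phiN_eq_eisScattering hΓ hneg hd hF κ hvol hinfty hper hineq hcomplete hY i j hs hre]
  exact resolventIdentity_Lp_of_kernel hΓ hneg hd hF hvol hinfty hper hineq hcomplete hY hk hL hBk hM i hre

include hvol hinfty hper hineq hcomplete hY in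
/-- **The continued residual vanishes on punctured neighbourhoods of every point of the strip.**
[folklore] -/
theorem residK_eventually_eq_zero (hk : IsTestKernel k) (hL : LipschitzWith L k) (hBk : ∀ u, |k u| ≤ Bk)
    (hM : ∀ u, M ≤ u → k u = 0) (i : Fin h) {s : ℂ} (hs : s ∈ κ.strip) :
    ∀ᶠ w in 𝓝[≠] s, residK hΓ hneg hd hF σ κ Y hk hL.continuous i w = 0 := by
  refine (meromorphicOn_residK hΓ hneg hd hF κ hvol hinfty hper hineq hY hk hL hBk hM i).eventually_eq_zero_of_eventually_eq_zero
    κ.isPreconnected_strip (baseParam_mem_strip κ) ?_ hs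
  have h1 : ∀ᶠ w in 𝓝 baseParam, w ∈ κ.strip ∩ {s : ℂ | 1 < s.re} :=
    (isOpen_strip_inter κ).mem_nhds (baseParam_mem_strip_inter κ)
  exact (h1.mono fun w hw => residK_eq_zero_of_one_lt_re hΓ hneg hd hF κ hvol hinfty hper hineq hcomplete hY
    hk hL hBk hM i hw.1 hw.2).filter_mono nhdsWithin_le_nhds

include hvol hinfty hper hineq hcomplete hY in
/-- **The resolvent identity survives the continuation, for every operator kernel**: at every point
of the strip where `v^κᵢ` and all `φ^κᵢⱼ` are analytic and for every Lipschitz test kernel `k`,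
`(T_k - ĥ_k(s)) ι v^κᵢ(s) + [a_{k,i}^s] + Σⱼ φ^κᵢⱼ(s) [a_{k,j}^{1-s}] = 0` — i.e.
`(L_k - ĥ_k(s)) Ẽᵢ(·, s) = 0` a.e. on `F`. [cite: Iwaniec2002, §6.2 (6.10)–(6.18) & §6.3 (before (6.20)), PDF pp. 84–86] -/
theorem residK_eq_zero (hk : IsTestKernel k) (hL : LipschitzWith L k) (hBk : ∀ u, |k u| ≤ Bk)
    (hM : ∀ u, M ≤ u → k u = 0) (i : Fin h) {s : ℂ} (hs : s ∈ κ.strip)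
    (hv : AnalyticAt ℂ (vN hΓ hneg hd hF σ κ Y i) s) (hφ : ∀ j, AnalyticAt ℂ (phiN hΓ hneg hd hF σ κ Y i j) s) :
    residK hΓ hneg hd hF σ κ Y hk hL.continuous i s = 0 := by
  refine (meromorphicOn_residK hΓ hneg hd hF κ hvol hinfty hper hineq hY hk hL hBk hM i).eq_zero_of_eventually_eq_zero
    κ.isPreconnected_strip hs
    (residK_eventually_eq_zero hΓ hneg hd hF κ hvol hinfty hper hineq hcomplete hY hk hL hBk hM i hs) hs ?_
  have hvc : ContinuousAt (fun s => ((vN hΓ hneg hd hF σ κ Y i s : pseudoCuspSubmodule hΓ hneg hd hF σ Y) :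
      Lp ℂ 2 (volume.restrict F))) s :=
    (((pseudoCuspSubmodule hΓ hneg hd hF σ Y).subtypeL).comp_analyticAt' hv).continuousAt
  have ha := analyticOnNhd_tailDefectLp (F := F) hΓ hneg hd hvol hinfty hper hineq hk hL hBk hM
  unfold residK
  refine ((((kernelCLM hΓ hneg hd hF hk hL.continuous).continuous.continuousAt.comp hvc).sub
    ((analyticAt_eigenvalueFn hk s).continuousAt.smul hvc)).add (ha i hY s (mem_univ _)).continuousAt).add ?_
  exact tendsto_finsetSum _ fun j _ =>
    (hφ j).continuousAt.smul (((ha j hY) (1 - s) (mem_univ _)).comp (analyticAt_const.sub analyticAt_id)).continuousAt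

/-- **At a point of the strip, `v^κᵢ` is either analytic or has a pole with value `0`** (normal form).
[folklore] -/
theorem analyticAt_vN_or (i : Fin h) {s : ℂ} (hs : s ∈ κ.strip) :
    AnalyticAt ℂ (vN hΓ hneg hd hF σ κ Y i) s ∨
      (meromorphicOrderAt (vN hΓ hneg hd hF σ κ Y i) s < 0 ∧ vN hΓ hneg hd hF σ κ Y i s = 0) := by
  rcases meromorphicNFAt_iff_analyticAt_or.mp ((meromorphicNFOn_vN hΓ hneg hd hF σ κ Y i) hs) with h | h
  · exact Or.inl h
  · exact Or.inr ⟨h.2.1, h.2.2⟩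

/-- The same for `φ^κᵢⱼ`. [folklore] -/
theorem analyticAt_phiN_or (i j : Fin h) {s : ℂ} (hs : s ∈ κ.strip) :
    AnalyticAt ℂ (phiN hΓ hneg hd hF σ κ Y i j) s ∨
      (meromorphicOrderAt (phiN hΓ hneg hd hF σ κ Y i j) s < 0 ∧ phiN hΓ hneg hd hF σ κ Y i j s = 0) := by
  rcases meromorphicNFAt_iff_analyticAt_or.mp ((meromorphicNFOn_phiN hΓ hneg hd hF σ κ Y i j) hs) with h | h
  · exact Or.inl h
  · exact Or.inr ⟨h.2.1, h.2.2⟩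

include hvol hinfty hper hineq hcomplete hY in
/-- **Independence of the kernel**: two resolvent kernels give the same continuation on the common
part of their strips. [folklore] -/
theorem phiN_eqOn_inter (κ' : RKernel) (i j : Fin h) :
    EqOn (phiN hΓ hneg hd hF σ κ Y i j) (phiN hΓ hneg hd hF σ κ' Y i j) (κ.strip ∩ κ'.strip) := by
  refine ((meromorphicNFOn_phiN hΓ hneg hd hF σ κ Y i j).mono' inter_subset_left).eqOn_of_eventuallyEq
    ((meromorphicNFOn_phiN hΓ hneg hd hF σ κ' Y i j).mono' inter_subset_right)
    ((κ.convex_strip.inter κ'.convex_strip).isPreconnected) ⟨baseParam_mem_strip κ, baseParam_mem_strip κ'⟩ ?_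
  exact ((phiN_eventuallyEq_baseParam hΓ hneg hd hF κ hvol hinfty hper hineq hcomplete hY i j).trans
    (phiN_eventuallyEq_baseParam hΓ hneg hd hF κ' hvol hinfty hper hineq hcomplete hY i j).symm).nhdsNE_of_nhds

include hvol hinfty hper hineq hcomplete hY in
/-- The same for `v`. [folklore] -/
theorem vN_eqOn_inter (κ' : RKernel) (i : Fin h) :
    EqOn (vN hΓ hneg hd hF σ κ Y i) (vN hΓ hneg hd hF σ κ' Y i) (κ.strip ∩ κ'.strip) := by
  refine ((meromorphicNFOn_vN hΓ hneg hd hF σ κ Y i).mono' inter_subset_left).eqOn_of_eventuallyEq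
    ((meromorphicNFOn_vN hΓ hneg hd hF σ κ' Y i).mono' inter_subset_right)
    ((κ.convex_strip.inter κ'.convex_strip).isPreconnected) ⟨baseParam_mem_strip κ, baseParam_mem_strip κ'⟩ ?_
  exact ((vN_eventuallyEq_baseParam hΓ hneg hd hF κ hvol hinfty hper hineq hcomplete hY i).trans
    (vN_eventuallyEq_baseParam hΓ hneg hd hF κ' hvol hinfty hper hineq hcomplete hY i).symm).nhdsNE_of_nhds

end NormalForms

end Fuchsian

end Literature.NumberTheory.Automorphic
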